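import Summits.Ventures.LatticeQCDFlow.Exactness.Phi4HMCCarreDuChamp
import Summits.Ventures.LatticeQCDFlow.Exactness.HMCMomentumMoments
import Summits.Ventures.LatticeQCDFlow.Exactness.Phi4HMCEnergyViolationIntegrable
import HarnessLib

/-!
# Polynomial-envelope observables under an HMC-type update: the class `PolyObs` (magnetisation and action themselves)

HONEST FRAMING: exact (Metropolis-corrected) sampling algorithms for lattice gauge theory;
figures of merit are autocorrelation/cost numbers at stated couplings and volumes; no
continuum-physics claim.  (SCALAR calibration rung S0-A: not a gauge result.)

Venture `LatticeQCDFlow` (cell pub-lqcd), topic `Exactness`; FANOUT row 2 (`s0-phi4`, HMC arm).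
NEW WORK of the cell.  The HMC floors of `Phi4HMCActionCSD` / `Phi4HMCOneStepCSD` are stated on the
bounded class `BddObs` (so for the CLIPPED action and magnetisation at every clip level).  This file
opens the admissible-class framework `RevOp` to the observables themselves: the class `PolyObs` of
measurable observables with a polynomial envelope `|f φ| ≤ B (1 + Σ_w φ_w²)^k` contains the
magnetisation `Σ_x φ_x` and the action `S`, is an algebra, its products are integrable against
`e^{−S}` (coercive action), and it is STABLE under the HMC-type update `hmcOpOf J λ Ψ` for every
proposal map `Ψ` of polynomial growth in the size `s(φ,p) = 1 + Σφ² + Σp²` (row 2's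
`Phi4LeapfrogGrowth.phaseSize_iterate_le`: the qpq leapfrog trajectory of any length is such a map).
Nothing is cited as a fact.

## What is proved (`Λ = Fin (n+1)`; `env φ = 1 + Σ_w φ_w²`)

* `PolyObs` (def), `polyObs_of_bddObs`, `polyObs_const`, `polyObs_add_mul`, `polyObs_mul`,
  `polyObs_sq`, **`polyObs_magnetisation`** (`|Σφ| ≤ (n+1) env`), **`polyObs_action`**
  (`|S| ≤ (Σ|J| + |λ| + 1) env²`);
* `integrable_env_pow_mul_gibbsWeight` — `env^k e^{−S}` is integrable under coercivity (marginal of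
  `s^k e^{−H}`, `Phi4HMCEnergyViolationIntegrable`); `polyObs_integrable_mul_mul_gibbsWeight` — (int);
* `hmcOpOf_integrand_abs_le_poly`, `integrable_hmcOpOf_integrand_poly`, **`polyObs_hmcOpOf`** — for
  `Ψ` measurable with `s(Ψ z) ≤ C s(z)^m`: `K_Ψ` maps `PolyObs` to `PolyObs` (stab);
  `hmcOpOf_add_mul_poly` — (lin); `hmcProposal_growth` — the qpq proposal has polynomial growth.

(symm), (contr) on the class and the floors for `S` and `M` themselves are
`Exactness/Phi4HMCPolyObsFloor.lean`.
-/

namespace Summit.Ventures.LatticeQCDFlow.Exactness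

open Real MeasureTheory Filter Finset
open Summit.Ventures.LatticeQCDFlow.Scoring

section PolyObs

variable {n : ℕ}

/-- The admissible class of observables of POLYNOMIAL GROWTH on `ℝ^Λ`: measurable with
`|f φ| ≤ B (1 + Σ_w φ_w²)^k` for some `B`, `k` (contains the magnetisation, the action, and every
polynomial).  A standard growth class, no single source. [folklore] -/
@[folklore]
def PolyObs (f : (Fin (n + 1) → ℝ) → ℝ) : Prop :=
  Measurable f ∧ ∃ B : ℝ, ∃ k : ℕ, ∀ φ, |f φ| ≤ B * (1 + ∑ w, φ w ^ 2) ^ k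

/-- `1 ≤ env`. -/
theorem one_le_env (φ : Fin (n + 1) → ℝ) : 1 ≤ 1 + ∑ w, φ w ^ 2 := by
  have h : 0 ≤ ∑ w, φ w ^ 2 := sum_nonneg fun _ _ => sq_nonneg _
  linarith

/-- Powers of the envelope are monotone in the exponent. -/
theorem env_pow_mono {j k : ℕ} (hjk : j ≤ k) (φ : Fin (n + 1) → ℝ) :
    (1 + ∑ w, φ w ^ 2) ^ j ≤ (1 + ∑ w, φ w ^ 2) ^ k :=
  pow_le_pow_right₀ (one_le_env φ) hjk

/-- A nonneg envelope constant can always be used: `|f| ≤ B env^k ⇒ |f| ≤ |B| env^k`. -/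
theorem abs_le_abs_mul_env {f : (Fin (n + 1) → ℝ) → ℝ} {B : ℝ} {k : ℕ}
    (h : ∀ φ, |f φ| ≤ B * (1 + ∑ w, φ w ^ 2) ^ k) (φ : Fin (n + 1) → ℝ) :
    |f φ| ≤ |B| * (1 + ∑ w, φ w ^ 2) ^ k :=
  (h φ).trans (mul_le_mul_of_nonneg_right (le_abs_self B)
    (pow_nonneg (zero_le_one.trans (one_le_env φ)) _))

/-- Bounded observables are polynomial-envelope observables (`k = 0`). -/
theorem polyObs_of_bddObs {f : (Fin (n + 1) → ℝ) → ℝ} (hf : BddObs f) : PolyObs f := by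
  obtain ⟨hfm, B, hfb⟩ := hf
  exact ⟨hfm, B, 0, fun φ => by simpa using hfb φ⟩

/-- Constants. -/
theorem polyObs_const (c : ℝ) : PolyObs (fun _ : Fin (n + 1) → ℝ => c) :=
  polyObs_of_bddObs (bddObs_const c)

/-- The class is closed under `f + c h`. -/
theorem polyObs_add_mul {f h : (Fin (n + 1) → ℝ) → ℝ} (hf : PolyObs f) (hh : PolyObs h) (c : ℝ) :
    PolyObs (fun φ => f φ + c * h φ) := by
  obtain ⟨hfm, Bf, kf, hfb⟩ := hf
  obtain ⟨hhm, Bh, kh, hhb⟩ := hh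
  refine ⟨hfm.add (measurable_const.mul hhm), |Bf| + |c| * |Bh|, kf + kh, fun φ => ?_⟩
  have e0 : 0 ≤ (1 + ∑ w, φ w ^ 2) ^ (kf + kh) := pow_nonneg (zero_le_one.trans (one_le_env φ)) _
  have h1 : |f φ| ≤ |Bf| * (1 + ∑ w, φ w ^ 2) ^ (kf + kh) :=
    (abs_le_abs_mul_env hfb φ).trans
      (mul_le_mul_of_nonneg_left (env_pow_mono (Nat.le_add_right kf kh) φ) (abs_nonneg _))
  have h2 : |h φ| ≤ |Bh| * (1 + ∑ w, φ w ^ 2) ^ (kf + kh) :=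
    (abs_le_abs_mul_env hhb φ).trans
      (mul_le_mul_of_nonneg_left (env_pow_mono (Nat.le_add_left kh kf) φ) (abs_nonneg _))
  calc |f φ + c * h φ| ≤ |f φ| + |c| * |h φ| := by
        rw [← abs_mul]; exact abs_add_le _ _
    _ ≤ |Bf| * (1 + ∑ w, φ w ^ 2) ^ (kf + kh) + |c| * (|Bh| * (1 + ∑ w, φ w ^ 2) ^ (kf + kh)) :=
        add_le_add h1 (mul_le_mul_of_nonneg_left h2 (abs_nonneg c))
    _ = (|Bf| + |c| * |Bh|) * (1 + ∑ w, φ w ^ 2) ^ (kf + kh) := by ring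

/-- The class is closed under products. -/
theorem polyObs_mul {f h : (Fin (n + 1) → ℝ) → ℝ} (hf : PolyObs f) (hh : PolyObs h) :
    PolyObs (fun φ => f φ * h φ) := by
  obtain ⟨hfm, Bf, kf, hfb⟩ := hf
  obtain ⟨hhm, Bh, kh, hhb⟩ := hh
  refine ⟨hfm.mul hhm, |Bf| * |Bh|, kf + kh, fun φ => ?_⟩
  have e0 : ∀ j, 0 ≤ (1 + ∑ w, φ w ^ 2) ^ j := fun j => pow_nonneg (zero_le_one.trans (one_le_env φ)) _
  rw [abs_mul, pow_add]
  calc |f φ| * |h φ| ≤ (|Bf| * (1 + ∑ w, φ w ^ 2) ^ kf) * (|Bh| * (1 + ∑ w, φ w ^ 2) ^ kh) :=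
        mul_le_mul (abs_le_abs_mul_env hfb φ) (abs_le_abs_mul_env hhb φ) (abs_nonneg _)
          (mul_nonneg (abs_nonneg _) (e0 kf))
    _ = |Bf| * |Bh| * ((1 + ∑ w, φ w ^ 2) ^ kf * (1 + ∑ w, φ w ^ 2) ^ kh) := by ring

/-- The class is closed under squares. -/
theorem polyObs_sq {f : (Fin (n + 1) → ℝ) → ℝ} (hf : PolyObs f) : PolyObs (fun φ => f φ ^ 2) := by
  have h := polyObs_mul hf hf
  simpa [sq] using h

/-- **The magnetisation is a polynomial-envelope observable**: `|Σ_x φ_x| ≤ (n+1)(1 + Σ_w φ_w²)`. -/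
theorem polyObs_magnetisation : PolyObs (fun φ : Fin (n + 1) → ℝ => ∑ x, φ x) := by
  refine ⟨Finset.measurable_sum _ fun x _ => measurable_pi_apply x, (n : ℝ) + 1, 1, fun φ => ?_⟩
  have h1 : ∀ x, |φ x| ≤ 1 + φ x ^ 2 := fun x => by
    nlinarith [abs_nonneg (φ x), sq_abs (φ x), sq_nonneg (|φ x| - 1)]
  have hs : 0 ≤ ∑ w, φ w ^ 2 := sum_nonneg fun _ _ => sq_nonneg _
  calc |∑ x, φ x| ≤ ∑ x, |φ x| := abs_sum_le_sum_abs _ _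
    _ ≤ ∑ x, (1 + φ x ^ 2) := sum_le_sum fun x _ => h1 x
    _ = ((n : ℝ) + 1) + ∑ x, φ x ^ 2 := by
        rw [sum_add_distrib, sum_const, card_univ, Fintype.card_fin, nsmul_eq_mul, mul_one]
        push_cast; ring
    _ ≤ ((n : ℝ) + 1) * (1 + ∑ w, φ w ^ 2) ^ 1 := by
        rw [pow_one]
        nlinarith

/-- **The action is a polynomial-envelope observable**: `|S φ| ≤ (Σ|J| + |λ| + 1)(1 + Σ_w φ_w²)²`
(the tree's `abs_phi4HmcEnergy_le` at zero momentum). -/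
theorem polyObs_action (J : Fin (n + 1) → Fin (n + 1) → ℝ) (lam : ℝ) :
    PolyObs (latticePhi4Action J lam : (Fin (n + 1) → ℝ) → ℝ) := by
  refine ⟨(continuous_latticePhi4Action J lam).measurable, (∑ a, ∑ b, |J a b|) + |lam| + 1, 2,
    fun φ => ?_⟩
  have h := abs_phi4HmcEnergy_le J lam (φ, fun _ => 0)
  have hH : phi4HmcEnergy J lam (φ, fun _ => 0) = latticePhi4Action J lam φ := by
    simp [phi4HmcEnergy]
  have hs : phaseSize ((φ, fun _ => 0) : (Fin (n + 1) → ℝ) × (Fin (n + 1) → ℝ))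
      = 1 + ∑ w, φ w ^ 2 := by
    simp [phaseSize]
  rw [hH, hs] at h
  exact h

/-! ## Integrability: `env^k e^{−S} ∈ L¹` and products on the class -/

/-- `env(φ) ≤ s(φ, p)`. -/
theorem env_le_phaseSize (z : (Fin (n + 1) → ℝ) × (Fin (n + 1) → ℝ)) :
    1 + ∑ w, z.1 w ^ 2 ≤ phaseSize z := by
  unfold phaseSize
  have h : 0 ≤ ∑ w, z.2 w ^ 2 := sum_nonneg fun _ _ => sq_nonneg _
  linarith

/-- `s(φ, p) ≤ env(φ) · env(p)`. -/
theorem phaseSize_le_env_mul (z : (Fin (n + 1) → ℝ) × (Fin (n + 1) → ℝ)) :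
    phaseSize z ≤ (1 + ∑ w, z.1 w ^ 2) * (1 + ∑ w, z.2 w ^ 2) := by
  unfold phaseSize
  have h1 : 0 ≤ ∑ w, z.1 w ^ 2 := sum_nonneg fun _ _ => sq_nonneg _
  have h2 : 0 ≤ ∑ w, z.2 w ^ 2 := sum_nonneg fun _ _ => sq_nonneg _
  nlinarith [mul_nonneg h1 h2]

/-- **`env^k e^{−S}` is integrable** under a coercive action (it is `Z_p⁻¹ ×` the `p`-marginal of
`env(φ)^k e^{−H}`, which is dominated by `s^k e^{−H} ∈ L¹`). -/
theorem integrable_env_pow_mul_gibbsWeight {J : Fin (n + 1) → Fin (n + 1) → ℝ} {lam ε K : ℝ}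
    (hε : 0 < ε) (hS : ∀ φ : Fin (n + 1) → ℝ, ε * ∑ w, φ w ^ 2 - K ≤ latticePhi4Action J lam φ)
    (k : ℕ) :
    Integrable (fun φ : Fin (n + 1) → ℝ => (1 + ∑ w, φ w ^ 2) ^ k * gibbsWeight J lam φ) := by
  have henvm : Measurable fun φ : Fin (n + 1) → ℝ => (1 + ∑ w, φ w ^ 2) ^ k :=
    (measurable_const.add (Finset.measurable_sum _ fun w _ => (measurable_pi_apply w).pow_const 2)).pow_const k
  have hwm : Measurable (gibbsWeight J lam) := (continuous_gibbsWeight J lam).measurable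
  -- on phase space: `env(φ)^k w(φ) mw(p) ≤ s^k e^{−H}`; handle `k = 0` and `k ≥ 1` at once via `s^k ≤ s^{k+1}`/direct
  have hF : Integrable (fun z : (Fin (n + 1) → ℝ) × (Fin (n + 1) → ℝ) =>
      ((1 + ∑ w, z.1 w ^ 2) ^ k * gibbsWeight J lam z.1) * momentumWeight z.2)
      ((volume : Measure (Fin (n + 1) → ℝ)).prod volume) := by
    have hdom := integrable_phaseSize_pow_mul_exp_neg hε hS k
    refine Integrable.mono' hdom
      ((((henvm.comp measurable_fst).mul (hwm.comp measurable_fst)).mul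
        (measurable_momentumWeight.comp measurable_snd)).aestronglyMeasurable)
      (Eventually.of_forall fun z => ?_)
    have h0 : 0 ≤ (1 + ∑ w, z.1 w ^ 2) ^ k := pow_nonneg (zero_le_one.trans (one_le_env z.1)) _
    rw [Real.norm_eq_abs, abs_mul, abs_mul, abs_of_nonneg h0, abs_of_pos (gibbsWeight_pos J lam _),
      abs_of_pos (momentumWeight_pos _), mul_assoc, ← exp_neg_phi4HmcEnergy J lam z]
    refine mul_le_mul_of_nonneg_right ?_ (Real.exp_pos _).le
    calc (1 + ∑ w, z.1 w ^ 2) ^ k ≤ phaseSize z ^ k :=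
          pow_le_pow_left₀ (zero_le_one.trans (one_le_env z.1)) (env_le_phaseSize z) k
      _ ≤ phaseSize z ^ (k + 1) := pow_le_pow_right₀ (one_le_phaseSize z) (Nat.le_succ k)
  have hmarg := hF.integral_norm_prod_left
  have e : ∀ φ : Fin (n + 1) → ℝ, ∫ p : Fin (n + 1) → ℝ,
      ‖((1 + ∑ w, φ w ^ 2) ^ k * gibbsWeight J lam φ) * momentumWeight p‖
      = ((1 + ∑ w, φ w ^ 2) ^ k * gibbsWeight J lam φ) * momentumZ n := by
    intro φ
    have h0 : 0 ≤ (1 + ∑ w, φ w ^ 2) ^ k * gibbsWeight J lam φ :=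
      mul_nonneg (pow_nonneg (zero_le_one.trans (one_le_env φ)) _) (gibbsWeight_pos J lam φ).le
    have e1 : ∀ p : Fin (n + 1) → ℝ, ‖((1 + ∑ w, φ w ^ 2) ^ k * gibbsWeight J lam φ) * momentumWeight p‖
        = ((1 + ∑ w, φ w ^ 2) ^ k * gibbsWeight J lam φ) * momentumWeight p := fun p => by
      rw [Real.norm_eq_abs, abs_of_nonneg (mul_nonneg h0 (momentumWeight_pos p).le)]
    simp_rw [e1]
    rw [integral_const_mul]
    rfl
  simp_rw [e] at hmarg
  have h := hmarg.mul_const (momentumZ n)⁻¹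
  refine h.congr (Eventually.of_forall fun φ => ?_)
  have hZ := (momentumZ_pos n).ne'
  field_simp

/-- **(int)** Products of two polynomial-envelope observables are integrable against `e^{−S}`. -/
theorem polyObs_integrable_mul_mul_gibbsWeight {J : Fin (n + 1) → Fin (n + 1) → ℝ} {lam ε K : ℝ}
    (hε : 0 < ε) (hS : ∀ φ : Fin (n + 1) → ℝ, ε * ∑ w, φ w ^ 2 - K ≤ latticePhi4Action J lam φ)
    {f h : (Fin (n + 1) → ℝ) → ℝ} (hf : PolyObs f) (hh : PolyObs h) :
    Integrable (fun φ => f φ * h φ * gibbsWeight J lam φ) := by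
  obtain ⟨hm, B, k, hb⟩ := polyObs_mul hf hh
  refine Integrable.mono' ((integrable_env_pow_mul_gibbsWeight hε hS k).const_mul |B|)
    ((hf.1.mul hh.1).mul (continuous_gibbsWeight J lam).measurable).aestronglyMeasurable
    (Eventually.of_forall fun φ => ?_)
  rw [Real.norm_eq_abs, abs_mul, abs_of_pos (gibbsWeight_pos J lam φ), ← mul_assoc]
  exact mul_le_mul_of_nonneg_right (abs_le_abs_mul_env hb φ) (gibbsWeight_pos J lam φ).le

/-! ## Stability: the HMC-type update maps the class to itself -/

/-- **Envelope of the HMC integrand.**  `f` with `|f| ≤ B env^k` (`0 ≤ B`), `Ψ` with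
`s(Ψ z) ≤ C s(z)^m` (`0 ≤ C`): for `z = (φ, p)`,
`|a f((Ψ z).1) + (1 − a) f(φ)| ≤ B (C^k + 1) env(φ)^{mk+k} env(p)^{mk+k}`. -/
theorem hmcOpOf_integrand_abs_le_poly (J : Fin (n + 1) → Fin (n + 1) → ℝ) (lam : ℝ)
    {Ψ : (Fin (n + 1) → ℝ) × (Fin (n + 1) → ℝ) → (Fin (n + 1) → ℝ) × (Fin (n + 1) → ℝ)}
    {C : ℝ} {m : ℕ} (hC : 0 ≤ C) (hΨg : ∀ z, phaseSize (Ψ z) ≤ C * phaseSize z ^ m)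
    {f : (Fin (n + 1) → ℝ) → ℝ} {B : ℝ} {k : ℕ} (hB : 0 ≤ B)
    (hfb : ∀ φ, |f φ| ≤ B * (1 + ∑ w, φ w ^ 2) ^ k) (z : (Fin (n + 1) → ℝ) × (Fin (n + 1) → ℝ)) :
    |involAccept (phi4HmcEnergy J lam) Ψ z * f (Ψ z).1
        + (1 - involAccept (phi4HmcEnergy J lam) Ψ z) * f z.1|
      ≤ B * (C ^ k + 1) * ((1 + ∑ w, z.1 w ^ 2) ^ (m * k + k) * (1 + ∑ w, z.2 w ^ 2) ^ (m * k + k)) := by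
  have ha0 := involAccept_nonneg (phi4HmcEnergy J lam) Ψ z
  have ha1 := involAccept_le_one (phi4HmcEnergy J lam) Ψ z
  have hs1 := one_le_phaseSize z
  have hs0 : 0 ≤ phaseSize z := (phaseSize_pos z).le
  set T := phaseSize z ^ (m * k + k) with hT
  have hT1 : 1 ≤ T := one_le_pow₀ hs1
  -- the proposal term
  have h1 : |f (Ψ z).1| ≤ B * C ^ k * T := by
    calc |f (Ψ z).1| ≤ B * (1 + ∑ w, (Ψ z).1 w ^ 2) ^ k := hfb _
      _ ≤ B * phaseSize (Ψ z) ^ k :=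
          mul_le_mul_of_nonneg_left
            (pow_le_pow_left₀ (zero_le_one.trans (one_le_env _)) (env_le_phaseSize (Ψ z)) k) hB
      _ ≤ B * (C * phaseSize z ^ m) ^ k :=
          mul_le_mul_of_nonneg_left (pow_le_pow_left₀ (phaseSize_pos _).le (hΨg z) k) hB
      _ = B * C ^ k * phaseSize z ^ (m * k) := by rw [mul_pow, ← pow_mul]; ring
      _ ≤ B * C ^ k * T :=
          mul_le_mul_of_nonneg_left (pow_le_pow_right₀ hs1 (Nat.le_add_right _ _))
            (mul_nonneg hB (pow_nonneg hC _))
  -- the stay term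
  have h2 : |f z.1| ≤ B * T := by
    calc |f z.1| ≤ B * (1 + ∑ w, z.1 w ^ 2) ^ k := hfb _
      _ ≤ B * phaseSize z ^ k :=
          mul_le_mul_of_nonneg_left
            (pow_le_pow_left₀ (zero_le_one.trans (one_le_env _)) (env_le_phaseSize z) k) hB
      _ ≤ B * T := mul_le_mul_of_nonneg_left (pow_le_pow_right₀ hs1 (Nat.le_add_left _ _)) hB
  have hT' : T ≤ (1 + ∑ w, z.1 w ^ 2) ^ (m * k + k) * (1 + ∑ w, z.2 w ^ 2) ^ (m * k + k) := by
    rw [hT, ← mul_pow]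
    exact pow_le_pow_left₀ hs0 (phaseSize_le_env_mul z) _
  have hBC : 0 ≤ B * (C ^ k + 1) := mul_nonneg hB (by positivity)
  calc |involAccept (phi4HmcEnergy J lam) Ψ z * f (Ψ z).1
        + (1 - involAccept (phi4HmcEnergy J lam) Ψ z) * f z.1|
      ≤ involAccept (phi4HmcEnergy J lam) Ψ z * |f (Ψ z).1|
        + (1 - involAccept (phi4HmcEnergy J lam) Ψ z) * |f z.1| := by
          refine (abs_add_le _ _).trans ?_
          rw [abs_mul, abs_mul, abs_of_nonneg ha0, abs_of_nonneg (sub_nonneg.2 ha1)]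
    _ ≤ involAccept (phi4HmcEnergy J lam) Ψ z * (B * C ^ k * T)
        + (1 - involAccept (phi4HmcEnergy J lam) Ψ z) * (B * T) :=
          add_le_add (mul_le_mul_of_nonneg_left h1 ha0) (mul_le_mul_of_nonneg_left h2 (sub_nonneg.2 ha1))
    _ ≤ B * (C ^ k + 1) * T := by
          have hCk : 0 ≤ B * C ^ k * T := mul_nonneg (mul_nonneg hB (pow_nonneg hC _)) (zero_le_one.trans hT1)
          have hBT : 0 ≤ B * T := mul_nonneg hB (zero_le_one.trans hT1)
          nlinarith
    _ ≤ B * (C ^ k + 1) * ((1 + ∑ w, z.1 w ^ 2) ^ (m * k + k) * (1 + ∑ w, z.2 w ^ 2) ^ (m * k + k)) :=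
          mul_le_mul_of_nonneg_left hT' hBC

/-- `env(p)^j e^{−½Σp²}` is integrable (the momentum law is a coercive Gibbs law). -/
theorem integrable_env_pow_mul_momentumWeight (j : ℕ) :
    Integrable (fun p : Fin (n + 1) → ℝ => (1 + ∑ w, p w ^ 2) ^ j * momentumWeight p) := by
  have h := integrable_env_pow_mul_gibbsWeight (n := n) (by norm_num : (0 : ℝ) < 1 / 2)
    momentum_coercive j
  exact h.congr (Eventually.of_forall fun p => by simp only [momentumWeight_eq_gibbsWeight])

/-- The HMC integrand of a polynomial-envelope observable is integrable in the momenta, for every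
configuration (growth hypothesis on `Ψ`). -/
theorem integrable_hmcOpOf_integrand_poly (J : Fin (n + 1) → Fin (n + 1) → ℝ) (lam : ℝ)
    {Ψ : (Fin (n + 1) → ℝ) × (Fin (n + 1) → ℝ) → (Fin (n + 1) → ℝ) × (Fin (n + 1) → ℝ)}
    (hΨm : Measurable Ψ) {C : ℝ} {m : ℕ} (hC : 0 ≤ C)
    (hΨg : ∀ z, phaseSize (Ψ z) ≤ C * phaseSize z ^ m)
    {f : (Fin (n + 1) → ℝ) → ℝ} (hf : PolyObs f) (φ : Fin (n + 1) → ℝ) :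
    Integrable (fun p : Fin (n + 1) → ℝ =>
      (involAccept (phi4HmcEnergy J lam) Ψ (φ, p) * f (Ψ (φ, p)).1
        + (1 - involAccept (phi4HmcEnergy J lam) Ψ (φ, p)) * f φ) * momentumWeight p) := by
  obtain ⟨hfm, B, k, hfb⟩ := hf
  have hfb' := abs_le_abs_mul_env hfb
  have hHm := measurable_phi4HmcEnergy J lam
  have ha : Measurable fun p : Fin (n + 1) → ℝ => involAccept (phi4HmcEnergy J lam) Ψ (φ, p) :=
    (measurable_involAccept hHm hΨm).comp (measurable_const.prodMk measurable_id)
  have hmeas : Measurable fun p : Fin (n + 1) → ℝ =>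
      (involAccept (phi4HmcEnergy J lam) Ψ (φ, p) * f (Ψ (φ, p)).1
        + (1 - involAccept (phi4HmcEnergy J lam) Ψ (φ, p)) * f φ) * momentumWeight p :=
    ((ha.mul (hfm.comp (measurable_fst.comp (hΨm.comp (measurable_const.prodMk measurable_id))))).add
      ((measurable_const.sub ha).mul measurable_const)).mul measurable_momentumWeight
  set A : ℝ := |B| * (C ^ k + 1) * (1 + ∑ w, φ w ^ 2) ^ (m * k + k) with hA
  refine Integrable.mono' ((integrable_env_pow_mul_momentumWeight (m * k + k)).const_mul A)
    hmeas.aestronglyMeasurable (Eventually.of_forall fun p => ?_)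
  rw [Real.norm_eq_abs, abs_mul, abs_of_pos (momentumWeight_pos p)]
  have h := hmcOpOf_integrand_abs_le_poly J lam hC hΨg (abs_nonneg B) hfb' (φ, p)
  calc |involAccept (phi4HmcEnergy J lam) Ψ (φ, p) * f (Ψ (φ, p)).1
        + (1 - involAccept (phi4HmcEnergy J lam) Ψ (φ, p)) * f φ| * momentumWeight p
      ≤ |B| * (C ^ k + 1) * ((1 + ∑ w, φ w ^ 2) ^ (m * k + k) * (1 + ∑ w, p w ^ 2) ^ (m * k + k))
          * momentumWeight p := mul_le_mul_of_nonneg_right h (momentumWeight_pos p).le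
    _ = A * ((1 + ∑ w, p w ^ 2) ^ (m * k + k) * momentumWeight p) := by rw [hA]; ring

/-- **(stab) THE HMC-TYPE UPDATE MAPS `PolyObs` TO ITSELF** for every measurable proposal map of
polynomial growth `s(Ψ z) ≤ C s(z)^m`:
`|K_Ψ f(φ)| ≤ B (C^k + 1) (Z_p⁻¹ ∫ env(p)^{mk+k} e^{−½Σp²} dp) · env(φ)^{mk+k}`. -/
theorem polyObs_hmcOpOf (J : Fin (n + 1) → Fin (n + 1) → ℝ) (lam : ℝ)
    {Ψ : (Fin (n + 1) → ℝ) × (Fin (n + 1) → ℝ) → (Fin (n + 1) → ℝ) × (Fin (n + 1) → ℝ)}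
    (hΨm : Measurable Ψ) {C : ℝ} {m : ℕ} (hC : 0 ≤ C)
    (hΨg : ∀ z, phaseSize (Ψ z) ≤ C * phaseSize z ^ m)
    {f : (Fin (n + 1) → ℝ) → ℝ} (hf : PolyObs f) : PolyObs (hmcOpOf J lam Ψ f) := by
  obtain ⟨hfm, B, k, hfb⟩ := hf
  have hfb' := abs_le_abs_mul_env hfb
  have hHm := measurable_phi4HmcEnergy J lam
  have hZ := momentumZ_pos n
  -- joint measurability of the integrand
  have hG : Measurable fun z : (Fin (n + 1) → ℝ) × (Fin (n + 1) → ℝ) =>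
      (involAccept (phi4HmcEnergy J lam) Ψ z * f (Ψ z).1
        + (1 - involAccept (phi4HmcEnergy J lam) Ψ z) * f z.1) * momentumWeight z.2 :=
    (((measurable_involAccept hHm hΨm).mul (hfm.comp (measurable_fst.comp hΨm))).add
      ((measurable_const.sub (measurable_involAccept hHm hΨm)).mul (hfm.comp measurable_fst))).mul
      (measurable_momentumWeight.comp measurable_snd)
  set I : ℝ := ∫ p : Fin (n + 1) → ℝ, (1 + ∑ w, p w ^ 2) ^ (m * k + k) * momentumWeight p with hI
  refine ⟨?_, |B| * (C ^ k + 1) * I / momentumZ n, m * k + k, fun φ => ?_⟩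
  · exact (hG.stronglyMeasurable.integral_prod_right'
      (ν := (volume : Measure (Fin (n + 1) → ℝ)))).measurable.div_const (momentumZ n)
  · unfold hmcOpOf
    rw [abs_div, abs_of_pos hZ, div_mul_eq_mul_div, div_le_div_iff_of_pos_right hZ]
    set A : ℝ := |B| * (C ^ k + 1) * (1 + ∑ w, φ w ^ 2) ^ (m * k + k) with hA
    have hbound := norm_integral_le_of_norm_le
      ((integrable_env_pow_mul_momentumWeight (n := n) (m * k + k)).const_mul A)
      (Eventually.of_forall fun p : Fin (n + 1) → ℝ => (show
        ‖(involAccept (phi4HmcEnergy J lam) Ψ (φ, p) * f (Ψ (φ, p)).1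
          + (1 - involAccept (phi4HmcEnergy J lam) Ψ (φ, p)) * f φ) * momentumWeight p‖
          ≤ A * ((1 + ∑ w, p w ^ 2) ^ (m * k + k) * momentumWeight p) from by
        rw [Real.norm_eq_abs, abs_mul, abs_of_pos (momentumWeight_pos p)]
        have h := hmcOpOf_integrand_abs_le_poly J lam hC hΨg (abs_nonneg B) hfb' (φ, p)
        calc |involAccept (phi4HmcEnergy J lam) Ψ (φ, p) * f (Ψ (φ, p)).1
              + (1 - involAccept (phi4HmcEnergy J lam) Ψ (φ, p)) * f φ| * momentumWeight p
            ≤ |B| * (C ^ k + 1) * ((1 + ∑ w, φ w ^ 2) ^ (m * k + k)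
                * (1 + ∑ w, p w ^ 2) ^ (m * k + k)) * momentumWeight p :=
              mul_le_mul_of_nonneg_right h (momentumWeight_pos p).le
          _ = A * ((1 + ∑ w, p w ^ 2) ^ (m * k + k) * momentumWeight p) := by rw [hA]; ring))
    rw [integral_const_mul, Real.norm_eq_abs] at hbound
    calc |∫ p, (involAccept (phi4HmcEnergy J lam) Ψ (φ, p) * f (Ψ (φ, p)).1
            + (1 - involAccept (phi4HmcEnergy J lam) Ψ (φ, p)) * f φ) * momentumWeight p|
        ≤ A * I := hbound
      _ = |B| * (C ^ k + 1) * I * (1 + ∑ w, φ w ^ 2) ^ (m * k + k) := by rw [hA]; ring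

/-- **(lin)** The HMC-type update is linear on `PolyObs` (growth hypothesis on `Ψ`). -/
theorem hmcOpOf_add_mul_poly (J : Fin (n + 1) → Fin (n + 1) → ℝ) (lam : ℝ)
    {Ψ : (Fin (n + 1) → ℝ) × (Fin (n + 1) → ℝ) → (Fin (n + 1) → ℝ) × (Fin (n + 1) → ℝ)}
    (hΨm : Measurable Ψ) {C : ℝ} {m : ℕ} (hC : 0 ≤ C)
    (hΨg : ∀ z, phaseSize (Ψ z) ≤ C * phaseSize z ^ m)
    {f h : (Fin (n + 1) → ℝ) → ℝ} (hf : PolyObs f) (hh : PolyObs h) (c : ℝ) (φ : Fin (n + 1) → ℝ) :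
    hmcOpOf J lam Ψ (fun s => f s + c * h s) φ = hmcOpOf J lam Ψ f φ + c * hmcOpOf J lam Ψ h φ := by
  unfold hmcOpOf
  have hIf := integrable_hmcOpOf_integrand_poly J lam hΨm hC hΨg hf φ
  have hIh := integrable_hmcOpOf_integrand_poly J lam hΨm hC hΨg hh φ
  have e : ∀ p : Fin (n + 1) → ℝ,
      (involAccept (phi4HmcEnergy J lam) Ψ (φ, p) * (f (Ψ (φ, p)).1 + c * h (Ψ (φ, p)).1)
        + (1 - involAccept (phi4HmcEnergy J lam) Ψ (φ, p)) * (f φ + c * h φ)) * momentumWeight p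
      = (involAccept (phi4HmcEnergy J lam) Ψ (φ, p) * f (Ψ (φ, p)).1
          + (1 - involAccept (phi4HmcEnergy J lam) Ψ (φ, p)) * f φ) * momentumWeight p
        + c * ((involAccept (phi4HmcEnergy J lam) Ψ (φ, p) * h (Ψ (φ, p)).1
          + (1 - involAccept (phi4HmcEnergy J lam) Ψ (φ, p)) * h φ) * momentumWeight p) :=
    fun p => by ring
  simp_rw [e]
  rw [integral_add hIf (hIh.const_mul c), integral_const_mul]
  ring

/-- **Row 2's qpq proposal map has polynomial growth**: for every `J`, `λ`, `δ`, `N` there is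
`C ≥ 1` with `s(hmcProposal z) ≤ C s(z)^{4^N}`. -/
theorem hmcProposal_growth (J : Fin (n + 1) → Fin (n + 1) → ℝ) (lam δ : ℝ) (N : ℕ) :
    ∃ C : ℝ, 1 ≤ C ∧ ∀ z : (Fin (n + 1) → ℝ) × (Fin (n + 1) → ℝ),
      phaseSize (hmcProposal J lam δ N z) ≤ C * phaseSize z ^ (4 ^ N) := by
  obtain ⟨C, hC1, hC⟩ := phaseSize_iterate_le J lam δ N
  refine ⟨C, hC1, fun z => ?_⟩
  unfold hmcProposal
  rw [phaseSize_momFlip]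
  exact hC z

end PolyObs

end Summit.Ventures.LatticeQCDFlow.Exactness
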